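import Summits.AtomisticToContinuum.FouriersLaw.Theorems.JunctionLocalityNonBallisticOfWindow
import Summits.AtomisticToContinuum.FouriersLaw.Theorems.JunctionLocalityNonBallisticWindowOfLocalityAndDrude

/-!
# Split glue for crux `NonBallistic` (stmt-AtomisticToContinuum-9127), route `JunctionLocality`

Crux-strategist decomposition (D-0019 two-layer split, planner-filed): the crux
`JunctionLocality.NonBallistic` (`liminf_N D_N/(N-1) = 0`, shared verbatim with `PuiseuxTransferLedger` and
`BondHeatUncertainty`) follows from THREE typed pieces, each a genuine statement and none a rewording of the crux:

1. `ExtensiveSnapshotIrreversibility` — (K), VERBATIM the signature of route item stmt-AtomisticToContinuum-9121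
   (`BondHeatUncertainty.ExtensiveSnapshotIrreversibility`): `KL(μ_{N,δ} ‖ Θ_*μ_{N,δ}) ≤ C·N·δ²` eventually as `δ → 0`
   (NESS statics; true for the harmonic member, `K_N = N/6 - 2/9`);
2. `FixedTimeCurrentLocality` — thermodynamic limit AT FIXED TIME of the per-site equilibrium time-integrated
   total-current variance of the OPEN chain: `∃ v, ∀ t > 0, V_N(t)/N → v(t)`, `V_N(t) = 2∫₀ᵗ(t-s)C_N(s)ds`
   (harmonic-true: exact `1/N` law; almost-finite propagation speed + Gibbs clustering; no infinite-volume object named);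
3. `ZeroDrudeWeightLiminf` — the open core, the ONLY piece using `0 < lam, 0 < β`: `∀ ε > 0 ∃ t > 0, v(t) ≤ ε t²`
   (`v(t)/t² = B_t(J)²`, the finite-time ballistic norm of the current of the infinite pinned chain; its limit is the
   Drude weight `D(T)`; FALSE for the harmonic member, `v(t)/t² = χ_j = 0.190983…`).

The implication is the composition of two LANDED theorems of lead c2's line `drude-controls-conductance` (R1):
`subballisticTransitWindow_of_fixedTimeLocality_of_zeroDrudeWeight` (p123204: pieces 2 ∧ 3 ⇒ the windowed
sub-ballistic variance `DrudeLine.SubballisticTransitWindow` with `a = 1` and a FIXED window `t(ε)`) and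
`nonBallistic_of_subballisticTransitWindow` (p123886: (K) ∧ window ⇒ crux, through the proved total-current
fluctuation-theorem uncertainty relation and the six landed fixed-`N` stubs). The three hypotheses below are spelled
out verbatim (fully qualified) as they are filed as the children of the split; (K) is definitionally the
`BondHeatUncertainty` decl.
-/

noncomputable section

namespace Summit.AtomisticToContinuum.FouriersLaw.Theorems.NonBallistic

open MeasureTheory Filter Topology
open scoped NNReal ENNReal BigOperators

/-- **Split glue** `ExtensiveSnapshotIrreversibility → FixedTimeCurrentLocality → ZeroDrudeWeightLiminf → NonBallistic`
(children spelled verbatim; proof = composition of p123204 and p123886). -/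
theorem nonBallistic_of_subs :
    (∀ ω₂ lam β γ : ℝ, 0 < ω₂ → 0 < lam → 0 < β → 0 < γ → (∀ (N : ℕ) (T_L T_R : ℝ), 0 < T_L → 0 < T_R → ∀ μ ν : MeasureTheory.Measure (Literature.MathematicalPhysics.KineticTheory.HeatConduction.PhaseSpace N), (Literature.MathematicalPhysics.KineticTheory.HeatConduction.pinnedChain ω₂ lam β γ).IsSteadyState N T_L T_R μ → (Literature.MathematicalPhysics.KineticTheory.HeatConduction.pinnedChain ω₂ lam β γ).IsSteadyState N T_L T_R ν → μ = ν) → ∀ μ : (N : ℕ) → ℝ → ℝ → MeasureTheory.Measure (Literature.MathematicalPhysics.KineticTheory.HeatConduction.PhaseSpace N), (∀ (N : ℕ) (T_L T_R : ℝ), 0 < T_L → 0 < T_R → (Literature.MathematicalPhysics.KineticTheory.HeatConduction.pinnedChain ω₂ lam β γ).IsSteadyState N T_L T_R (μ N T_L T_R)) → ∀ T : ℝ, 0 < T → ∃ C : ℝ, ∀ N : ℕ, ∀ᶠ δ in nhdsWithin (0 : ℝ) {(0 : ℝ)}ᶜ, InformationTheory.klDiv (μ N (T + δ / 2) (T - δ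 / 2)) (MeasureTheory.Measure.map (fun x : Literature.MathematicalPhysics.KineticTheory.HeatConduction.PhaseSpace N => (x.1, -x.2)) (μ N (T + δ / 2) (T - δ / 2))) ≤ ENNReal.ofReal (C * (N : ℝ) * δ ^ 2)) →
    (∀ ω₂ lam β γ : ℝ, 0 < ω₂ → 0 < lam → 0 < β → 0 < γ → ∀ T : ℝ, 0 < T → ∀ C : ℕ → ℝ → ℝ, C = (fun (N : ℕ) (s : ℝ) => ∫ x, (∑ i : Fin N, (Literature.MathematicalPhysics.KineticTheory.HeatConduction.pinnedChain ω₂ lam β γ).bondCurrent N i x) * (∫ y, (∑ i : Fin N, (Literature.MathematicalPhysics.KineticTheory.HeatConduction.pinnedChain ω₂ lam β γ).bondCurrent N i y) ∂((Literature.MathematicalPhysics.KineticTheory.HeatConduction.pinnedChain ω₂ lam β γ).transitionKernel N T T s.toNNReal x)) ∂((Literature.MathematicalPhysics.KineticTheory.HeatConduction.pinnedChain ω₂ lam β γ).gibbsMeasure N T)) → ∃ v : ℝ → ℝ, ∀ t : ℝ, 0 < t → Filter.Tendsto (fun N : ℕ => (2 * ∫ s in (0 : ℝ)..t, (t - s)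 * C N s) / (N : ℝ)) Filter.atTop (nhds (v t))) →
    (∀ ω₂ lam β γ : ℝ, 0 < ω₂ → 0 < lam → 0 < β → 0 < γ → ∀ T : ℝ, 0 < T → ∀ C : ℕ → ℝ → ℝ, C = (fun (N : ℕ) (s : ℝ) => ∫ x, (∑ i : Fin N, (Literature.MathematicalPhysics.KineticTheory.HeatConduction.pinnedChain ω₂ lam β γ).bondCurrent N i x) * (∫ y, (∑ i : Fin N, (Literature.MathematicalPhysics.KineticTheory.HeatConduction.pinnedChain ω₂ lam β γ).bondCurrent N i y) ∂((Literature.MathematicalPhysics.KineticTheory.HeatConduction.pinnedChain ω₂ lam β γ).transitionKernel N T T s.toNNReal x)) ∂((Literature.MathematicalPhysics.KineticTheory.HeatConduction.pinnedChain ω₂ lam β γ).gibbsMeasure N T)) → ∀ v : ℝ → ℝ, (∀ t : ℝ, 0 < t → Filter.Tendsto (fun N : ℕ => (2 * ∫ s in (0 : ℝ)..t, (t - s) * C N s) / (N : ℝ)) Filter.atTop (nhds (v t))) → ∀ ε : ℝ, 0 < ε → ∃ t : ℝ, 0 < t ∧ v t ≤ ε * t ^ 2) →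
    Summit.AtomisticToContinuum.FouriersLaw.Theses.JunctionLocality.NonBallistic :=
  fun hK hL hZ =>
    nonBallistic_of_subballisticTransitWindow hK
      (subballisticTransitWindow_of_fixedTimeLocality_of_zeroDrudeWeight hL hZ)

/-- The first child is, by `Iff.rfl`, the `BondHeatUncertainty` route item (K) stmt-AtomisticToContinuum-9121
(so the split child deduplicates onto that item). -/
example :
    (∀ ω₂ lam β γ : ℝ, 0 < ω₂ → 0 < lam → 0 < β → 0 < γ → (∀ (N : ℕ) (T_L T_R : ℝ), 0 < T_L → 0 < T_R → ∀ μ ν : MeasureTheory.Measure (Literature.MathematicalPhysics.KineticTheory.HeatConduction.PhaseSpace N), (Literature.MathematicalPhysics.KineticTheory.HeatConduction.pinnedChain ω₂ lam β γ).IsSteadyState N T_L T_R μ → (Literature.MathematicalPhysics.KineticTheory.HeatConduction.pinnedChain ω₂ lam β γ).IsSteadyState N T_L T_R ν → μ = ν) → ∀ μ : (N : ℕ) → ℝ → ℝ → MeasureTheory.Measure (Literature.MathematicalPhysics.KineticTheory.HeatConduction.PhaseSpace N), (∀ (N : ℕ) (T_L T_R : ℝ), 0 < T_L → 0 < T_R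 → (Literature.MathematicalPhysics.KineticTheory.HeatConduction.pinnedChain ω₂ lam β γ).IsSteadyState N T_L T_R (μ N T_L T_R)) → ∀ T : ℝ, 0 < T → ∃ C : ℝ, ∀ N : ℕ, ∀ᶠ δ in nhdsWithin (0 : ℝ) {(0 : ℝ)}ᶜ, InformationTheory.klDiv (μ N (T + δ / 2) (T - δ / 2)) (MeasureTheory.Measure.map (fun x : Literature.MathematicalPhysics.KineticTheory.HeatConduction.PhaseSpace N => (x.1, -x.2)) (μ N (T + δ / 2) (T - δ / 2))) ≤ ENNReal.ofReal (C * (N : ℝ) * δ ^ 2))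
      ↔ Summit.AtomisticToContinuum.FouriersLaw.Theses.BondHeatUncertainty.ExtensiveSnapshotIrreversibility :=
  Iff.rfl

end Summit.AtomisticToContinuum.FouriersLaw.Theorems.NonBallistic

end
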